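import Summits.Schanuel.Schanuel.Theorems.ZilberEacFibreCurvePuiseux
import HarnessLib

/-!
# The exponential-polynomial regime, CIX: ESTIMATES AND BOOKKEEPING for the degenerate direction
# (calculus of evaluations, polynomial growth, super-exponential smallness, edge rows)

HONEST FRAMING.  Cell `pub-schanuel` (Zilber's Exponential-Algebraic Closedness, case ladder;
host summit Schanuel), seat 2, gen 34.  Infrastructure for file CX (exponential points of a
surface whose fibre relation involves both `y₀` and `y₁`, along an unbounded place in a direction
where `y₁ = e^{x₁} → 0` super-exponentially):
* Part A — differentiability of `q ↦ G(v(q); Y(q))` for `G ∈ ℂ[x₀, x₁, y₁][y₀]`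
  (`differentiableAt_mvEval₃`, `differentiableAt_polyMap_eval₃`);
* Part B — polynomial growth `|c(v)| ≤ X^{deg c} Σ|c_m|` and the perturbation bound
  `|c(x₀, x₁, y₁) − c(x₀, x₁, 0)| ≤ |y₁| X^{deg c} Σ|c_m|` (`norm_eval₃_le`, `norm_eval₃_sub_le`);
* Part C — super-exponential smallness beats every power: `t^{-N} e^{-c t^{-q}} → 0` as `t → 0⁺`
  (`tendsto_zpow_neg_mul_exp_neg`); the direction constant
  `Re(Φ(σ) z^M u^{-n}) ≤ −c` near `(σ, u) = (0, 1)` when `Re(Φ(0) z^M) < 0` (`exists_direction_const`);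
* Part D — EDGE ROWS: rows `Q_i = φ_i(σ)σ^{m_i}` (or `≡ 0`) and a weight `L` give `ν ∈ ℤ` and
  analytic `α_i` with `Q_i σ^{Li} = σ^ν α_i`, some `α_i(0) ≠ 0` (`exists_edgeRows`); a row sum with
  a nonzero coefficient is nonzero at some `Y ≠ 0` (`exists_ne_zero_rowSum_ne_zero`).
[folklore]; nothing here bears on Mantova–Masser's question (OPEN), EC(3,2) (OPEN) or Schanuel's
conjecture (neither used nor implied); EAC ⇏ SC.
-/

noncomputable section

open Filter Topology Metric Complex Polynomial

set_option linter.dupNamespace false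

namespace Summit.Schanuel.Schanuel.Theorems

/-! ## Part A. Calculus of evaluations -/

/-- `q ↦ c(f q, g q, h q)` is differentiable for `c ∈ ℂ[X₀, X₁, X₂]` and differentiable
`f, g, h`. [folklore] -/
theorem differentiableAt_mvEval₃ {E : Type*} [NormedAddCommGroup E] [NormedSpace ℂ E]
    (c : MvPolynomial (Fin 3) ℂ) {f g h : E → ℂ} {p : E} (hf : DifferentiableAt ℂ f p)
    (hg : DifferentiableAt ℂ g p) (hh : DifferentiableAt ℂ h p) :
    DifferentiableAt ℂ (fun q => MvPolynomial.eval ![f q, g q, h q] c) p := by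
  induction c using MvPolynomial.induction_on with
  | C a =>
      simp only [MvPolynomial.eval_C]
      exact differentiableAt_const _
  | add p' q' hp hq =>
      simp only [map_add]
      exact hp.add hq
  | mul_X p' i hp =>
      simp only [map_mul, MvPolynomial.eval_X]
      fin_cases i
      · exact hp.mul (by simpa using hf)
      · exact hp.mul (by simpa using hg)
      · exact hp.mul (by simpa using hh)

/-- `q ↦ G(f q, g q, h q; Y q)` is differentiable for `G ∈ ℂ[X₀, X₁, X₂][Y]`. [folklore] -/
theorem differentiableAt_polyMap_eval₃ {E : Type*} [NormedAddCommGroup E] [NormedSpace ℂ E]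
    (G : Polynomial (MvPolynomial (Fin 3) ℂ)) {f g h Y : E → ℂ} {p : E}
    (hf : DifferentiableAt ℂ f p) (hg : DifferentiableAt ℂ g p) (hh : DifferentiableAt ℂ h p)
    (hY : DifferentiableAt ℂ Y p) :
    DifferentiableAt ℂ (fun q => (G.map (MvPolynomial.eval ![f q, g q, h q])).eval (Y q)) p := by
  have heq : (fun q => (G.map (MvPolynomial.eval ![f q, g q, h q])).eval (Y q)) = fun q =>
      ∑ j ∈ Finset.range (G.natDegree + 1),
        MvPolynomial.eval ![f q, g q, h q] (G.coeff j) * Y q ^ j := by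
    funext q
    exact eval_map_eq_rowSum G _ le_rfl _
  rw [heq]
  refine DifferentiableAt.fun_sum fun j _ => ?_
  exact (differentiableAt_mvEval₃ (G.coeff j) hf hg hh).mul (hY.pow j)

/-! ## Part B. Polynomial growth and the perturbation bound -/

/-- The degree of a monomial in three variables. [folklore] -/
theorem finsupp_sum_fin_three (m : Fin 3 →₀ ℕ) : (m.sum fun _ e => e) = m 0 + m 1 + m 2 := by
  rw [Finsupp.sum_fintype _ _ (by simp), Fin.sum_univ_three]

/-- The `ℓ¹`-size of the coefficients. [folklore] -/
theorem coeffSum_nonneg (c : MvPolynomial (Fin 3) ℂ) : 0 ≤ ∑ m ∈ c.support, ‖c.coeff m‖ :=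
  Finset.sum_nonneg fun _ _ => norm_nonneg _

/-- **Polynomial growth.**  `|c(v)| ≤ X^{deg c} · Σ_m |c_m|` when `|v_i| ≤ X`, `X ≥ 1`. [folklore] -/
theorem norm_eval₃_le (c : MvPolynomial (Fin 3) ℂ) (v : Fin 3 → ℂ) {X : ℝ} (hX : 1 ≤ X)
    (hv : ∀ i, ‖v i‖ ≤ X) :
    ‖MvPolynomial.eval v c‖ ≤ X ^ c.totalDegree * ∑ m ∈ c.support, ‖c.coeff m‖ := by
  rw [MvPolynomial.eval_eq', Finset.mul_sum]
  refine (norm_sum_le _ _).trans (Finset.sum_le_sum fun m hm => ?_)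
  rw [norm_mul, mul_comm]
  refine mul_le_mul_of_nonneg_right ?_ (norm_nonneg _)
  rw [Fin.prod_univ_three, norm_mul, norm_mul, norm_pow, norm_pow, norm_pow]
  have hdeg : m 0 + m 1 + m 2 ≤ c.totalDegree := by
    have := MvPolynomial.le_totalDegree hm
    rwa [finsupp_sum_fin_three] at this
  have a0 : ‖v 0‖ ^ m 0 ≤ X ^ m 0 := pow_le_pow_left₀ (norm_nonneg _) (hv 0) _
  have a1 : ‖v 1‖ ^ m 1 ≤ X ^ m 1 := pow_le_pow_left₀ (norm_nonneg _) (hv 1) _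
  have a2 : ‖v 2‖ ^ m 2 ≤ X ^ m 2 := pow_le_pow_left₀ (norm_nonneg _) (hv 2) _
  calc ‖v 0‖ ^ m 0 * ‖v 1‖ ^ m 1 * ‖v 2‖ ^ m 2 ≤ X ^ m 0 * X ^ m 1 * X ^ m 2 :=
        mul_le_mul (mul_le_mul a0 a1 (by positivity) (by positivity)) a2 (by positivity)
          (by positivity)
    _ = X ^ (m 0 + m 1 + m 2) := by rw [pow_add, pow_add]
    _ ≤ X ^ c.totalDegree := pow_le_pow_right₀ hX hdeg

/-- **The perturbation bound.**  `|c(v) − c(w)| ≤ |v₂| · X^{deg c} · Σ_m |c_m|` when `w` is `v`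
with the third coordinate replaced by `0`, `|v₀|, |v₁| ≤ X` (`X ≥ 1`) and `|v₂| ≤ 1`. [folklore] -/
theorem norm_eval₃_sub_le (c : MvPolynomial (Fin 3) ℂ) (v w : Fin 3 → ℂ) (hw0 : w 0 = v 0)
    (hw1 : w 1 = v 1) (hw2 : w 2 = 0) {X : ℝ} (hX : 1 ≤ X) (h0 : ‖v 0‖ ≤ X) (h1 : ‖v 1‖ ≤ X)
    (h2 : ‖v 2‖ ≤ 1) :
    ‖MvPolynomial.eval v c - MvPolynomial.eval w c‖ ≤
      ‖v 2‖ * X ^ c.totalDegree * ∑ m ∈ c.support, ‖c.coeff m‖ := by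
  rw [MvPolynomial.eval_eq', MvPolynomial.eval_eq', ← Finset.sum_sub_distrib, Finset.mul_sum]
  refine (norm_sum_le _ _).trans (Finset.sum_le_sum fun m hm => ?_)
  rw [← mul_sub, norm_mul, Fin.prod_univ_three, Fin.prod_univ_three, hw0, hw1, hw2]
  have hdeg : m 0 + m 1 + m 2 ≤ c.totalDegree := by
    have := MvPolynomial.le_totalDegree hm
    rwa [finsupp_sum_fin_three] at this
  rcases Nat.eq_zero_or_pos (m 2) with h2z | h2p
  · rw [h2z, pow_zero, pow_zero, sub_self, norm_zero, mul_zero]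
    exact mul_nonneg (mul_nonneg (norm_nonneg _) (pow_nonneg (by linarith) _)) (norm_nonneg _)
  · rw [zero_pow h2p.ne', mul_zero, sub_zero, norm_mul, norm_mul, norm_pow, norm_pow, norm_pow]
    have hv2 : ‖v 2‖ ^ m 2 ≤ ‖v 2‖ := pow_le_of_le_one (norm_nonneg _) h2 h2p.ne'
    have a0 : ‖v 0‖ ^ m 0 ≤ X ^ m 0 := pow_le_pow_left₀ (norm_nonneg _) h0 _
    have a1 : ‖v 1‖ ^ m 1 ≤ X ^ m 1 := pow_le_pow_left₀ (norm_nonneg _) h1 _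
    have h01 : X ^ m 0 * X ^ m 1 ≤ X ^ c.totalDegree := by
      rw [← pow_add]
      exact pow_le_pow_right₀ hX (by omega)
    calc ‖c.coeff m‖ * (‖v 0‖ ^ m 0 * ‖v 1‖ ^ m 1 * ‖v 2‖ ^ m 2)
        ≤ ‖c.coeff m‖ * (X ^ m 0 * X ^ m 1 * ‖v 2‖) := by
          refine mul_le_mul_of_nonneg_left ?_ (norm_nonneg _)
          exact mul_le_mul (mul_le_mul a0 a1 (by positivity) (by positivity)) hv2
            (by positivity) (by positivity)
      _ ≤ ‖c.coeff m‖ * (X ^ c.totalDegree * ‖v 2‖) := by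
          refine mul_le_mul_of_nonneg_left ?_ (norm_nonneg _)
          exact mul_le_mul_of_nonneg_right h01 (norm_nonneg _)
      _ = ‖v 2‖ * X ^ c.totalDegree * ‖c.coeff m‖ := by ring

/-! ## Part C. Super-exponential smallness and the direction constant -/

/-- **Super-exponential smallness beats every power**: `t^{-N} e^{-c t^{-q}} → 0` as `t → 0⁺`
(`c > 0`, `q ≥ 1`). [folklore] -/
theorem tendsto_zpow_neg_mul_exp_neg {c : ℝ} (hc : 0 < c) {q : ℕ} (hq : 1 ≤ q) (N : ℕ) :
    Tendsto (fun t : ℝ => t ^ (-(N : ℤ)) * Real.exp (-(c * t ^ (-(q : ℤ))))) (𝓝[>] 0) (𝓝 0) := by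
  have h1 : Tendsto (fun x : ℝ => x ^ N * Real.exp (-(c * x))) atTop (𝓝 0) := by
    have h := (Real.tendsto_pow_mul_exp_neg_atTop_nhds_zero N).comp (tendsto_id.const_mul_atTop hc)
    have h2 := h.const_mul (c ^ N)⁻¹
    rw [mul_zero] at h2
    refine h2.congr fun x => ?_
    simp only [Function.comp, id, mul_pow]
    field_simp
  have h3 : Tendsto (fun x : ℝ => x ^ N * Real.exp (-(c * x ^ q))) atTop (𝓝 0) := by
    refine squeeze_zero' ?_ ?_ h1
    · filter_upwards [eventually_ge_atTop 0] with x hx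
      positivity
    filter_upwards [eventually_ge_atTop 1] with x hx
    refine mul_le_mul_of_nonneg_left (Real.exp_le_exp.2 ?_) (by positivity)
    have : x ≤ x ^ q := le_self_pow₀ hx (by omega)
    nlinarith
  refine (h3.comp tendsto_inv_nhdsGT_zero).congr' ?_
  filter_upwards [self_mem_nhdsWithin] with t ht
  simp only [Function.comp, zpow_neg, zpow_natCast, inv_pow]

/-- **The direction constant.**  If `Φ` is continuous at `0` and `Re(Φ(0)·zM) < 0`, there are
`c, δ, η > 0` with `Re(Φ(σ)·zM·u^{-n}) ≤ −c` whenever `‖σ‖ < δ`, `‖u − 1‖ < η`. [folklore] -/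
theorem exists_direction_const {Φ : ℂ → ℂ} (hΦ : ContinuousAt Φ 0) (zM : ℂ) (n : ℕ)
    (hre : (Φ 0 * zM).re < 0) :
    ∃ c > 0, ∃ δ > 0, ∃ η > 0, ∀ σ u : ℂ, ‖σ‖ < δ → ‖u - 1‖ < η →
      (Φ σ * zM * (u ^ n)⁻¹).re ≤ -c := by
  set c : ℝ := -(Φ 0 * zM).re / 2 with hc
  have hc0 : 0 < c := by rw [hc]; linarith
  have hcont : ContinuousAt (fun p : ℂ × ℂ => Φ p.1 * zM * (p.2 ^ n)⁻¹) ((0 : ℂ), (1 : ℂ)) := by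
    have h1 : ContinuousAt (fun p : ℂ × ℂ => Φ p.1) ((0 : ℂ), (1 : ℂ)) :=
      ContinuousAt.comp (f := Prod.fst) (g := Φ) (x := ((0 : ℂ), (1 : ℂ))) hΦ continuousAt_fst
    have h2 : ContinuousAt (fun p : ℂ × ℂ => (p.2 ^ n)⁻¹) ((0 : ℂ), (1 : ℂ)) :=
      ((continuous_snd.pow n).continuousAt).inv₀ (by simp)
    exact (h1.mul continuousAt_const).mul h2
  obtain ⟨δ, hδ, h⟩ := Metric.continuousAt_iff.1 hcont c hc0
  refine ⟨c, hc0, δ, hδ, δ, hδ, fun σ u hσ hu => ?_⟩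
  have hd : dist (σ, u) ((0 : ℂ), (1 : ℂ)) < δ := by
    rw [Prod.dist_eq, dist_eq_norm, dist_eq_norm, sub_zero]
    exact max_lt hσ hu
  have h' := h hd
  rw [dist_eq_norm] at h'
  simp only [one_pow, inv_one, mul_one] at h'
  have hre' := (abs_le.1 ((Complex.abs_re_le_norm _).trans h'.le)).2
  rw [Complex.sub_re] at hre'
  rw [hc] at hre' ⊢
  linarith

/-! ## Part D. Edge rows -/

/-- **Edge rows.**  Rows `Q_0, …, Q_d` on a punctured neighbourhood of `0`, each either `≡ 0` or
of the form `φ_i(σ)σ^{m_i}` (`φ_i` analytic, `φ_i(0) ≠ 0`), at least one of the second kind, and a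
weight `L ∈ ℤ`: there are `ν ∈ ℤ` and analytic `α_i` with `Q_i(σ)·(σ^L)^i = σ^ν·α_i(σ)` near
`σ ≠ 0` and some `α_i(0) ≠ 0` (the lowest weighted order). [folklore] -/
theorem exists_edgeRows (d : ℕ) (Q : ℕ → ℂ → ℂ) (L : ℤ)
    (hQ : ∀ i ∈ Finset.range (d + 1), (∀ᶠ σ in 𝓝[≠] (0 : ℂ), Q i σ = 0) ∨
      ∃ (φ : ℂ → ℂ) (m : ℤ), AnalyticAt ℂ φ 0 ∧ φ 0 ≠ 0 ∧
        ∀ᶠ σ in 𝓝[≠] (0 : ℂ), Q i σ = φ σ * σ ^ m)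
    (hne : ∃ i ∈ Finset.range (d + 1), ¬ ∀ᶠ σ in 𝓝[≠] (0 : ℂ), Q i σ = 0) :
    ∃ (ν : ℤ) (α : ℕ → ℂ → ℂ), (∀ i, AnalyticAt ℂ (α i) 0) ∧
      (∃ i ∈ Finset.range (d + 1), α i 0 ≠ 0) ∧
      ∀ i ∈ Finset.range (d + 1), ∀ᶠ σ in 𝓝[≠] (0 : ℂ), Q i σ * (σ ^ L) ^ i = σ ^ ν * α i σ := by
  classical
  -- the good indices and their data
  have hgood : ∀ i, (i ∈ Finset.range (d + 1) ∧ ¬ ∀ᶠ σ in 𝓝[≠] (0 : ℂ), Q i σ = 0) →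
      ∃ (φ : ℂ → ℂ) (m : ℤ), AnalyticAt ℂ φ 0 ∧ φ 0 ≠ 0 ∧
        ∀ᶠ σ in 𝓝[≠] (0 : ℂ), Q i σ = φ σ * σ ^ m :=
    fun i hi => (hQ i hi.1).resolve_left hi.2
  choose! φ m hφ hφ0 hQφ using hgood
  set S : Finset ℕ := (Finset.range (d + 1)).filter (fun i => ¬ ∀ᶠ σ in 𝓝[≠] (0 : ℂ), Q i σ = 0)
    with hS
  have hSne : S.Nonempty := by
    obtain ⟨i, hi, hi'⟩ := hne
    exact ⟨i, Finset.mem_filter.2 ⟨hi, hi'⟩⟩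
  have hSgood : ∀ i ∈ S, i ∈ Finset.range (d + 1) ∧ ¬ ∀ᶠ σ in 𝓝[≠] (0 : ℂ), Q i σ = 0 :=
    fun i hi => Finset.mem_filter.1 hi
  set ν : ℤ := S.inf' hSne (fun i => m i + L * i) with hν
  have hνle : ∀ i ∈ S, ν ≤ m i + L * i := fun i hi => Finset.inf'_le _ hi
  set α : ℕ → ℂ → ℂ := fun i =>
    if i ∈ S then fun σ => φ i σ * σ ^ (m i + L * i - ν).toNat else fun _ => 0 with hα
  refine ⟨ν, α, fun i => ?_, ?_, fun i hi => ?_⟩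
  · by_cases hiS : i ∈ S
    · have h1 : α i = fun σ => φ i σ * σ ^ (m i + L * i - ν).toNat := by
        rw [hα]; simp only [hiS, if_true]
      rw [h1]
      exact (hφ i (hSgood i hiS)).mul (analyticAt_id.pow _)
    · have h1 : α i = fun _ => 0 := by rw [hα]; simp only [hiS, if_false]
      rw [h1]
      exact analyticAt_const
  · obtain ⟨i₀, hi₀, hmin⟩ := Finset.exists_mem_eq_inf' hSne (fun i => m i + L * i)
    refine ⟨i₀, (hSgood i₀ hi₀).1, ?_⟩
    have h1 : α i₀ 0 = φ i₀ 0 * (0 : ℂ) ^ (m i₀ + L * i₀ - ν).toNat := by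
      rw [hα]; simp only [hi₀, if_true]
    have h2 : (m i₀ + L * i₀ - ν).toNat = 0 := by
      rw [hν, hmin]; simp
    rw [h1, h2, pow_zero, mul_one]
    exact hφ0 i₀ (hSgood i₀ hi₀)
  · by_cases hiS : i ∈ S
    · have h1 : α i = fun σ => φ i σ * σ ^ (m i + L * i - ν).toNat := by
        rw [hα]; simp only [hiS, if_true]
      have hnn : 0 ≤ m i + L * i - ν := by linarith [hνle i hiS]
      filter_upwards [hQφ i (hSgood i hiS), self_mem_nhdsWithin] with σ hσ hσ0
      rw [h1, hσ]
      simp only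
      have hσ0' : σ ≠ 0 := hσ0
      have e1 : (σ ^ L) ^ (i : ℕ) = σ ^ (L * (i : ℤ)) := by rw [← zpow_natCast, ← zpow_mul]
      have e2 : (σ : ℂ) ^ (m i + L * i - ν).toNat = σ ^ (m i + L * i - ν) := by
        rw [← zpow_natCast, Int.toNat_of_nonneg hnn]
      rw [e1, e2, mul_assoc, ← zpow_add₀ hσ0', mul_left_comm, ← zpow_add₀ hσ0']
      congr 2
      ring
    · have hzero : ∀ᶠ σ in 𝓝[≠] (0 : ℂ), Q i σ = 0 := by
        by_contra hne'
        exact hiS (Finset.mem_filter.2 ⟨hi, hne'⟩)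
      have h1 : α i = fun _ => 0 := by rw [hα]; simp only [hiS, if_false]
      filter_upwards [hzero] with σ hσ
      rw [hσ, h1, zero_mul, mul_zero]

/-- A row sum with a nonzero coefficient does not vanish at some `Y ≠ 0`. [folklore] -/
theorem exists_ne_zero_rowSum_ne_zero {c : ℕ → ℂ} {d : ℕ}
    (h : ∃ i ∈ Finset.range (d + 1), c i ≠ 0) :
    ∃ Y : ℂ, Y ≠ 0 ∧ ∑ i ∈ Finset.range (d + 1), c i * Y ^ i ≠ 0 := by
  classical
  set p : ℂ[X] := ∑ i ∈ Finset.range (d + 1), Polynomial.C (c i) * Polynomial.X ^ i with hp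
  have hp0 : p ≠ 0 := by
    obtain ⟨i, hi, hci⟩ := h
    intro hp0
    have h1 := coeff_rowPoly d c i
    rw [← hp, hp0, Polynomial.coeff_zero, if_pos (Finset.mem_range.1 hi)] at h1
    exact hci h1.symm
  have hfin : Set.Finite {Y : ℂ | p.IsRoot Y} := Polynomial.finite_setOf_isRoot hp0
  obtain ⟨Y, hY0, hYr⟩ := (Set.finite_singleton (0 : ℂ)).infinite_compl.exists_notMem_finite hfin
  refine ⟨Y, fun h0 => hY0 (by simp [h0]), fun hsum => hYr ?_⟩
  simp only [Set.mem_setOf_eq, Polynomial.IsRoot]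
  rw [hp, eval_rowPoly]
  exact hsum

end Summit.Schanuel.Schanuel.Theorems

end
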